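import Summits.CriticalPhenomena.PercolationContinuityZ3.Theorems.PercNearOneGluingNoHeavyLowerTailThreePartitionCubeCheckPacked
import Summits.CriticalPhenomena.PercolationContinuityZ3.Theorems.PercNearOneGluingNoHeavyLowerTailThreePartitionCubeProfile
import Summits.CriticalPhenomena.PercolationContinuityZ3.Theorems.PercNearOneGluingNoHeavyLowerTailSahiPair43LinkGreedy

/-!
# Twisted three-partition positivity (★★) = (M⁺-3) on SIX letters: soundness of the checker, II — **the packed profile, lane by lane**

Support file (cell `prim-sahi`, seat `prim-sahi-typer` gen 34; `--supports stmt-CriticalPhenomena-4575`).  Pure proofs plus one bookkeeping definition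
(`sprof`, the biased scalar profile); no `sorry`, standard axioms.  Lane arithmetic of typer gen 31/32 (`…SahiPair43Lanes`, `…SahiPair43LinkProfile`:
`ofLanes`, `extract_eq`, `foldl_lanes0`, `bt`, `bt_and_bt`, `btFMUL_and`, `biasV_eq`) re-used verbatim.
* `extractAll_getD` — entry `c` of `extractAll` is the lane vector of the bits `c` of the packed masks;
* **`packedProfile_getD`** — for a batch of masks `fU i, fV i < 2^(2^m)` (`2^m ≤ 64`), entry `y` of `packedProfile` at the twist `t` is the lane vector
  of the biased scalar profiles `sprof (mkTabs m) (fU i) (fV i) t y`;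
* **`sprof_eq`** — `sprof T U V t y = BIAS + (profileArr T U V t)[y]` (as integers): the biased scalar profile is the scalar profile of PART 1, hence
  (`…ThreePartitionCubeProfile`) `BIAS + N_t(𝒰,𝒱,{y})` on encoded families. [this work]
-/

namespace Summit.CriticalPhenomena.PercolationContinuityZ3.Theorems.ThreePartition.Cube

open Finset SahiGridPattern.Pair43
open scoped BigOperators

/-! ### The biased scalar profile -/

/-- The biased scalar profile of the pair of masks `(U,V)` at the twist `t` and the point `y` (mirrors `packedProfile` lane by lane). [this work] -/
def sprof (T : Tabs) (U V t y : ℕ) : ℕ :=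
  let r := (T.np - 1) ^^^ (y ^^^ t)
  let L := (T.subsL.getD r #[]).toList
  BIAS + bt (U &&& V) y * 2 ^ (T.pcT.getD r 0 + 1) + (L.map fun s => bt U (s ^^^ t) * bt V ((r ^^^ s) ^^^ t)).sum
    - (bt V y * (L.map fun s => bt U (s ^^^ t)).sum + bt U y * (L.map fun s => bt V (s ^^^ t)).sum
        + (L.map fun s => bt (U &&& V) (s ^^^ t)).sum)

/-- A sum of `0/1` values over a list is at most its length. [this work] -/
theorem sum_bt_le {β : Type} (l : List β) (g : β → ℕ) (h : ∀ b ∈ l, g b ≤ 1) : (l.map g).sum ≤ l.length :=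
  (list_sum_le l g 1 h).trans (by simp)

/-- The subset lists have at most `2^m` entries. [this work] -/
theorem subsL_length_le (m r : ℕ) (hr : r < 2 ^ m) : ((mkTabs m).subsL.getD r #[]).toList.length ≤ 2 ^ m := by
  rw [mkTabs_subsL_getD m r hr, List.toList_toArray]
  exact (List.length_filter_le _ _).trans (by simp)

/-- Members of the subset lists are codes. [this work] -/
theorem mem_subsL_lt {m r s : ℕ} (hr : r < 2 ^ m) (hs : s ∈ ((mkTabs m).subsL.getD r #[]).toList) : s < 2 ^ m := by
  rw [mkTabs_subsL_getD m r hr, List.toList_toArray, List.mem_filter, List.mem_range] at hs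
  exact hs.1

/-! ### The packed indicators -/

section Packed

/-- `2^64 ≤ 2^LW`. [this work] -/
theorem pow64_le_LW : (2 : ℕ) ^ 64 ≤ 2 ^ LW := Nat.pow_le_pow_right (by omega) (by decide)

/-- `0/1` products are `0/1`. [this work] -/
theorem bt_mul_bt_le (a x b z : ℕ) : bt a x * bt b z ≤ 1 := by
  have := bt_le a x; have := bt_le b z; nlinarith

variable {m nb : ℕ} (hm : 2 ^ m ≤ 64) {fU fV : ℕ → ℕ} (hU : ∀ i < nb, fU i < 2 ^ 64) (hV : ∀ i < nb, fV i < 2 ^ 64)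
include hm

include hU in
/-- **Entries of `extractAll`** (first masks): the lane vector of the bits `c`. [this work] -/
theorem extractAll_getD_U {c : ℕ} (hc : c < 2 ^ m) :
    (extractAll (mkTabs m) (ones nb) (ofLanes nb fU)).getD c 0 = ofLanes nb (fun i => bt (fU i) c) := by
  unfold extractAll
  rw [getD_ofFn _ _ (by rw [mkTabs_np]; exact hc)]
  exact extract_eq (fun i hi => (hU i hi).trans_le pow64_le_LW) (lt_of_lt_of_le hc (hm.trans (by decide)))

include hV in
/-- Entries of `extractAll` (second masks). [this work] -/
theorem extractAll_getD_V {c : ℕ} (hc : c < 2 ^ m) :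
    (extractAll (mkTabs m) (ones nb) (ofLanes nb fV)).getD c 0 = ofLanes nb (fun i => bt (fV i) c) :=
  extractAll_getD_U hm hV hc

include hU hV in
/-- Entries of the pointwise AND of the two `extractAll` tables. [this work] -/
theorem extractUV_getD {c : ℕ} (hc : c < 2 ^ m) :
    (Array.ofFn fun c : Fin (mkTabs m).np =>
        (extractAll (mkTabs m) (ones nb) (ofLanes nb fU)).getD c 0 &&& (extractAll (mkTabs m) (ones nb) (ofLanes nb fV)).getD c 0).getD c 0 =
      ofLanes nb (fun i => bt (fU i &&& fV i) c) := by
  rw [getD_ofFn _ _ (by rw [mkTabs_np]; exact hc)]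
  show (extractAll (mkTabs m) (ones nb) (ofLanes nb fU)).getD c 0 &&& (extractAll (mkTabs m) (ones nb) (ofLanes nb fV)).getD c 0 = _
  rw [extractAll_getD_U hm hU hc, extractAll_getD_V hm hV hc,
    ofLanes_and (fun i _ => (bt_lt13 _ _).trans pow13_lt_LW) (fun i _ => (bt_lt13 _ _).trans pow13_lt_LW)]
  refine ofLanes_congr fun i _ => ?_
  rw [bt_and_bt]; unfold bt bit01; rw [Nat.testBit_land]; cases (fU i).testBit c <;> cases (fV i).testBit c <;> simp

include hU hV in
/-- **`packedProfile` lane by lane**: for `t, y < 2^m ≤ 64`, entry `y` is the lane vector of the biased scalar profiles. [this work] -/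
theorem packedProfile_getD {t y : ℕ} (ht : t < 2 ^ m) (hy : y < 2 ^ m) :
    (packedProfile (mkTabs m) (ones nb) (extractAll (mkTabs m) (ones nb) (ofLanes nb fU)) (extractAll (mkTabs m) (ones nb) (ofLanes nb fV))
        (Array.ofFn fun c : Fin (mkTabs m).np =>
          (extractAll (mkTabs m) (ones nb) (ofLanes nb fU)).getD c 0 &&& (extractAll (mkTabs m) (ones nb) (ofLanes nb fV)).getD c 0) t).getD y 0 =
      ofLanes nb (fun i => sprof (mkTabs m) (fU i) (fV i) t y) := by
  have hnp : (mkTabs m).np = 2 ^ m := mkTabs_np m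
  set r := (2 ^ m - 1) ^^^ (y ^^^ t) with hr
  have hrlt : r < 2 ^ m := Nat.xor_lt_two_pow (Nat.sub_one_lt (Nat.pos_iff_ne_zero.1 (Nat.two_pow_pos m))) (Nat.xor_lt_two_pow hy ht)
  set L := ((mkTabs m).subsL.getD r #[]).toList with hL
  have hsL : ∀ s ∈ L, s < 2 ^ m := fun s hs => mem_subsL_lt hrlt hs
  have hx1 : ∀ s ∈ L, s ^^^ t < 2 ^ m := fun s hs => Nat.xor_lt_two_pow (hsL s hs) ht
  have hx2 : ∀ s ∈ L, (r ^^^ s) ^^^ t < 2 ^ m := fun s hs => Nat.xor_lt_two_pow (Nat.xor_lt_two_pow hrlt (hsL s hs)) ht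
  have hLlen : L.length ≤ 2 ^ m := subsL_length_le m r hrlt
  unfold packedProfile
  rw [getD_ofFn _ _ (by rw [hnp]; exact hy)]
  simp only [hnp]
  rw [← hr, ← Array.foldl_toList, ← Array.foldl_toList, ← Array.foldl_toList, ← Array.foldl_toList, ← hL]
  -- the four folds
  have e1 := foldl_lanes0 nb L _ (fun s i => bt (fU i) (s ^^^ t) * bt (fV i) ((r ^^^ s) ^^^ t)) (fun s hs => by
    show (extractAll (mkTabs m) (ones nb) (ofLanes nb fU)).getD (s ^^^ t) 0 &&&
        (extractAll (mkTabs m) (ones nb) (ofLanes nb fV)).getD ((r ^^^ s) ^^^ t) 0 = _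
    rw [extractAll_getD_U hm hU (hx1 s hs), extractAll_getD_V hm hV (hx2 s hs),
      ofLanes_and (fun i _ => (bt_lt13 _ _).trans pow13_lt_LW) (fun i _ => (bt_lt13 _ _).trans pow13_lt_LW)]
    exact ofLanes_congr fun i _ => bt_and_bt _ _ _ _)
  have e2 := foldl_lanes0 nb L _ (fun s i => bt (fU i) (s ^^^ t)) (fun s hs => extractAll_getD_U hm hU (hx1 s hs))
  have e3 := foldl_lanes0 nb L _ (fun s i => bt (fV i) (s ^^^ t)) (fun s hs => extractAll_getD_V hm hV (hx1 s hs))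
  have e4 := foldl_lanes0 nb L _ (fun s i => bt (fU i &&& fV i) (s ^^^ t)) (fun s hs => extractUV_getD hm hU hV (hx1 s hs))
  rw [e1, e2, e3, e4, extractUV_getD hm hU hV hy, extractAll_getD_U hm hU hy, extractAll_getD_V hm hV hy, biasV_eq]
  -- bounds on the small lanes
  have hsG : ∀ i, (L.map fun s => bt (fU i) (s ^^^ t) * bt (fV i) ((r ^^^ s) ^^^ t)).sum ≤ 64 := fun i =>
    (sum_bt_le L _ fun s _ => bt_mul_bt_le _ _ _ _).trans (hLlen.trans hm)
  have hsU : ∀ i, (L.map fun s => bt (fU i) (s ^^^ t)).sum ≤ 64 := fun i => (sum_bt_le L _ fun s _ => bt_le _ _).trans (hLlen.trans hm)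
  have hsV : ∀ i, (L.map fun s => bt (fV i) (s ^^^ t)).sum ≤ 64 := fun i => (sum_bt_le L _ fun s _ => bt_le _ _).trans (hLlen.trans hm)
  have hsW : ∀ i, (L.map fun s => bt (fU i &&& fV i) (s ^^^ t)).sum ≤ 64 := fun i =>
    (sum_bt_le L _ fun s _ => bt_le _ _).trans (hLlen.trans hm)
  -- positive part
  rw [ofLanes_shiftLeft, ofLanes_add, ofLanes_add]
  -- negative part
  rw [ofLanes_mul, ofLanes_mul,
    ofLanes_and (fun i _ => btFMUL_lt _ _) (fun i _ => (lt_of_le_of_lt (hsU i) (by norm_num) : _ < 2 ^ 13).trans pow13_lt_LW),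
    ofLanes_and (fun i _ => btFMUL_lt _ _) (fun i _ => (lt_of_le_of_lt (hsV i) (by norm_num) : _ < 2 ^ 13).trans pow13_lt_LW),
    ofLanes_add, ofLanes_add]
  rw [ofLanes_sub (fun i _ => ?_)]
  · refine ofLanes_congr fun i _ => ?_
    rw [btFMUL_and _ _ (lt_of_le_of_lt (hsU i) (by norm_num)), btFMUL_and _ _ (lt_of_le_of_lt (hsV i) (by norm_num))]
    unfold sprof
    simp only [hnp]
    rw [← hr, ← hL, mkTabs_pcT_getD m r hrlt]
  · rw [btFMUL_and _ _ (lt_of_le_of_lt (hsU i) (by norm_num)), btFMUL_and _ _ (lt_of_le_of_lt (hsV i) (by norm_num))]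
    have h1 : bt (fV i) y * (L.map fun s => bt (fU i) (s ^^^ t)).sum ≤ 64 := by
      have := bt_le (fV i) y; have := hsU i; nlinarith
    have h2 : bt (fU i) y * (L.map fun s => bt (fV i) (s ^^^ t)).sum ≤ 64 := by
      have := bt_le (fU i) y; have := hsV i; nlinarith
    have h3 := hsW i
    unfold BIAS; omega

end Packed

/-! ### The biased scalar profile is the scalar profile of PART 1 -/

/-- A sum of bits over a list is the length of the corresponding filter. [this work] -/
theorem sum_bt_eq_length (L : List ℕ) (p : ℕ → Bool) :
    (L.map fun s => bit01 (p s)).sum = (L.filter p).length := by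
  induction L with
  | nil => simp
  | cons a L ih =>
    rw [List.map_cons, List.sum_cons, ih, List.filter_cons]
    cases p a
    · simp [bit01]
    · simp [bit01]; omega

/-- A `0/1`-guarded value as a product. [this work] -/
theorem ite_testBit_eq_bt_mul (M c v : ℕ) : (if M.testBit c = true then v else 0) = bt M c * v := by
  unfold bt bit01; cases M.testBit c <;> simp

/-- **`sprof = BIAS + profileArr`** (as integers), for `t, y < 2^m ≤ 64`. [this work] -/
theorem sprof_eq (m : ℕ) (hm : 2 ^ m ≤ 64) (U V : ℕ) {t y : ℕ} (ht : t < 2 ^ m) (hy : y < 2 ^ m) :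
    (sprof (mkTabs m) U V t y : ℤ) = BIAS + (profileArr (mkTabs m) U V t).getD y 0 := by
  have hnp : (mkTabs m).np = 2 ^ m := mkTabs_np m
  set r := (2 ^ m - 1) ^^^ (y ^^^ t) with hr
  have hrlt : r < 2 ^ m := Nat.xor_lt_two_pow (Nat.sub_one_lt (Nat.pos_iff_ne_zero.1 (Nat.two_pow_pos m))) (Nat.xor_lt_two_pow hy ht)
  set L := ((mkTabs m).subsL.getD r #[]).toList with hL
  have hLlen : L.length ≤ 64 := (subsL_length_le m r hrlt).trans hm
  -- the scalar profile entry, as filter lengths over `L`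
  unfold profileArr
  rw [getD_ofFn _ _ (by rw [hnp]; exact hy)]
  simp only [hnp]
  rw [← hr, ← Array.foldl_toList, ← Array.foldl_toList, ← Array.foldl_toList, ← Array.foldl_toList, ← hL,
    foldl_count, foldl_count, foldl_count, foldl_count]
  simp only [Nat.zero_add]
  -- the biased profile, as the same filter lengths
  have eG : (L.map fun s => bt U (s ^^^ t) * bt V ((r ^^^ s) ^^^ t)).sum =
      (L.filter fun s => U.testBit (s ^^^ t) && V.testBit ((r ^^^ s) ^^^ t)).length := by
    rw [← sum_bt_eq_length]; congr 1; refine List.map_congr_left fun s _ => ?_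
    unfold bt bit01; cases U.testBit (s ^^^ t) <;> cases V.testBit ((r ^^^ s) ^^^ t) <;> simp
  have eU : (L.map fun s => bt U (s ^^^ t)).sum = (L.filter fun s => U.testBit (s ^^^ t)).length := sum_bt_eq_length L _
  have eV : (L.map fun s => bt V (s ^^^ t)).sum = (L.filter fun s => V.testBit (s ^^^ t)).length := sum_bt_eq_length L _
  have eW : (L.map fun s => bt (U &&& V) (s ^^^ t)).sum = (L.filter fun s => (U &&& V).testBit (s ^^^ t)).length :=
    sum_bt_eq_length L _
  unfold sprof
  simp only [hnp]
  rw [← hr, ← hL, eG, eU, eV, eW, ite_testBit_eq_bt_mul, ite_testBit_eq_bt_mul, ite_testBit_eq_bt_mul]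
  -- sizes
  have hb := List.length_filter_le (fun s => U.testBit (s ^^^ t)) L
  have hc := List.length_filter_le (fun s => V.testBit (s ^^^ t)) L
  have hd := List.length_filter_le (fun s => (U &&& V).testBit (s ^^^ t)) L
  have h1 : bt V y * (L.filter fun s => U.testBit (s ^^^ t)).length ≤ 64 := by have := bt_le V y; nlinarith
  have h2 : bt U y * (L.filter fun s => V.testBit (s ^^^ t)).length ≤ 64 := by have := bt_le U y; nlinarith
  have hle : bt V y * (L.filter fun s => U.testBit (s ^^^ t)).length + bt U y * (L.filter fun s => V.testBit (s ^^^ t)).length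
      + (L.filter fun s => (U &&& V).testBit (s ^^^ t)).length ≤
      BIAS + bt (U &&& V) y * 2 ^ ((mkTabs m).pcT.getD r 0 + 1)
        + (L.filter fun s => U.testBit (s ^^^ t) && V.testBit ((r ^^^ s) ^^^ t)).length := by
    unfold BIAS; omega
  have htop : bt (U &&& V) y * (2 <<< (mkTabs m).pcT.getD r 0) = bt (U &&& V) y * 2 ^ ((mkTabs m).pcT.getD r 0 + 1) := by
    rw [Nat.shiftLeft_eq, Nat.pow_succ, Nat.mul_comm (2 ^ _) 2]
  rw [htop]
  push_cast [Nat.cast_sub hle]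
  ring

end Summit.CriticalPhenomena.PercolationContinuityZ3.Theorems.ThreePartition.Cube
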